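import Summits.AnomalousDissipation.AnomalousDissipation.Theorems.SolenoidalFractalHomogenisationLagrangianStepCellLawVOddGainDefectStrict
import HarnessLib

/-!
# K1L `LagrangianRenormalisationStep(Design)` (K1L_D, stmt-AnomalousDissipation-27980; aside 24912), stub `stub_cellLawV0_IS`
# — W5 odd half, §4: SLOT-DEPENDENT WINDOWS and THE WINDOW CLAUSE DISCHARGED FOR SYMMETRIC BLOCKS
# (helper; `--supports stmt-AnomalousDissipation-27980`; on top of `…CellLawVOddGainDefectStrict` p650822)

Summits-side helper file of route `SolenoidalFractalHomogenisation`, fourth part of planner ad-ideate-p5 g8's `Cruxes/LagrangianRenormalisationStep/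
OddGainDefect.lean` (§1–§3 landed as `…CellLawVOddGainDefectGram` p649800 / `…Cubature` p650454 / `…Strict` p650822).
* `oddSectorial_excQS_strict_of_slotWindows` — the strict odd contraction `OddSectorial (excQS W₀ M S) ((c√5/3)·τ)` when each slot `s` has ITS OWN
  transverse window `[ylo s, yhi s]·|P_s x|²` and ONE box `[y, c·y]` contains them all (`y ≤ ylo s`, `yhi s ≤ c·y`); this is the shape in which the
  quasi-static slot responses arrive (`ylo s = f_{T_s}(hi)`, `yhi s = f_{T_s}(lo)`, `T_s = 4π²|m_s|²·M·τ_s`), the box ratio being the DESIGN number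
  `c = max_s f_{T_s}(lo) / min_s f_{T_s}(hi)` (memo `Cruxes/…/OddGain-Defect.md`: `c ≤ ΛV²·ϑ_∞/ϑ(ρ, T_axis·hi)·(1 + O(τ₀))`, `κ = c√5/3 < 1` for `c < 3/√5`).
* `qsResp_window_symm` / `qsResp_window_symm_projPerp` — THE WINDOW CLAUSE of `oddSectorial_excQS_strict_of_slot` PROVED for SYMMETRIC blocks:
  `B = Bᵀ`, `lo|x|² ≤ xᵀBx ≤ hi|x|²` (all `x`), `T ≥ 0` ⇒ `f_T(hi)|v|² ≤ vᵀ f_T(B) v ≤ f_T(lo)|v|²` on every vector, in particular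
  `f_T(hi)|P_s x|² ≤ (P_s x)ᵀ f_T(B) (P_s x) ≤ f_T(lo)|P_s x|²` (`f_T = qsRespScalar ρ T`) — the worker's Loewner pinch on an invariant hyperplane
  (`…CellLawVSemigroupPerp`, p642614) at the trivial hyperplane `u = 0`, fed into the quasi-static pinch (`…CellLawVQSResp`, p643071).
  This is the `τ = 0` skeleton of the remaining per-slot obligation (O2⁺); the sectorial (non-symmetric, `τ > 0`) block — window up to `(1 + O(τ))` by a
  Duhamel argument — is NOT treated here.
No named facts, no sorry.  NOT a proof of the stub, of the crux, of Onsager's conjecture or of anomalous dissipation — rung-leaf F-D1.A0 algebra.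
Planner seat `ad-ideate-p5` g8 (lens «profile»), 2026-08-28; Theorems-ready text for a prover lander.
-/

set_option linter.dupNamespace false

noncomputable section

namespace Summit.AnomalousDissipation.AnomalousDissipation.Theorems.SolenoidalFractalHomogenisation.LagrangianStep.OddGain

open Matrix Finset

/-! ## §4 Slot-dependent windows, and the window clause DISCHARGED for symmetric blocks (the `τ = 0` skeleton of O2⁺) -/

section Windows

open Literature.Analysis Literature.Analysis.FunctionSpaces Literature.Analysis.FluidPDE
open Literature.Analysis.FluidPDE.LatticeShear

/-- **Slot-dependent windows**: if slot `s` has its own transverse window `[ylo s, yhi s]·|P_s x|²` and ONE box `[y, c·y]` contains them all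
(`y ≤ ylo s`, `yhi s ≤ c·y`), the strict contraction `oddSectorial_excQS_strict` applies with that box. [folklore] -/
theorem oddSectorial_excQS_strict_of_slotWindows (Mlag : ℝ) (S : Torus.Visc4 (Fin 3)) {y c τ : ℝ} (hy : 0 ≤ y) (hc : 0 ≤ c) (hτ : 0 ≤ τ)
    (ylo yhi : Fin 26 → ℝ) (hlo : ∀ s, y ≤ ylo s) (hhi : ∀ s, yhi s ≤ c * y)
    (hsec : ∀ s, ∀ x z : Fin 3 → ℝ,
      (x ⬝ᵥ (slotQ cubatureWord Mlag S s) *ᵥ z - z ⬝ᵥ (slotQ cubatureWord Mlag S s) *ᵥ x) ^ 2 ≤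
        τ ^ 2 * ((x ⬝ᵥ (slotQ cubatureWord Mlag S s) *ᵥ x) * (z ⬝ᵥ (slotQ cubatureWord Mlag S s) *ᵥ z)))
    (hwin : ∀ s x, ylo s * perpSq (slotN s) x ≤ x ⬝ᵥ (slotQ cubatureWord Mlag S s) *ᵥ x ∧
      x ⬝ᵥ (slotQ cubatureWord Mlag S s) *ᵥ x ≤ yhi s * perpSq (slotN s) x) :
    OddSectorial (excQS cubatureWord Mlag S) (c * Real.sqrt 5 / 3 * τ) := by
  refine oddSectorial_excQS_strict Mlag S hy hc hτ hsec fun s x => ?_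
  have hP := perpSq_nonneg (slotN s) x (slotN_unit s)
  exact ⟨(mul_le_mul_of_nonneg_right (hlo s) hP).trans (hwin s x).1, (hwin s x).2.trans (mul_le_mul_of_nonneg_right (hhi s) hP)⟩

/-- `x·x = Σ xᵢ²`. -/
theorem dotProduct_self_eq_sum_sq (x : Fin 3 → ℝ) : x ⬝ᵥ x = ∑ i, x i ^ 2 := by
  simp [dotProduct, sq]

/-- **THE WINDOW CLAUSE FOR SYMMETRIC BLOCKS** (the `τ = 0` skeleton of the remaining per-slot obligation O2⁺): for a SYMMETRIC block `B`
with `lo|x|² ≤ xᵀBx ≤ hi|x|²` the quasi-static response is pinched `f_T(hi)|v|² ≤ vᵀ f_T(B) v ≤ f_T(lo)|v|²` on EVERY vector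
(`f_T = qsRespScalar ρ T`, `T ≥ 0`) — the worker's Loewner pinch (p642614, invariant hyperplane `u = 0`) fed into the quasi-static pinch (p643071).
For sectorial (non-symmetric) blocks the same window is expected up to `(1 + O(τ))` — NOT proved here. [folklore] -/
theorem qsResp_window_symm {ρ T lo hi : ℝ} (hT : 0 ≤ T) {B : Matrix (Fin 3) (Fin 3) ℝ} (hB : B.IsSymm)
    (hwin : ∀ x : Fin 3 → ℝ, lo * (x ⬝ᵥ x) ≤ x ⬝ᵥ B *ᵥ x ∧ x ⬝ᵥ B *ᵥ x ≤ hi * (x ⬝ᵥ x)) (v : Fin 3 → ℝ) :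
    qsRespScalar ρ T hi * (v ⬝ᵥ v) ≤ v ⬝ᵥ (qsResp ρ T B) *ᵥ v ∧ v ⬝ᵥ (qsResp ρ T B) *ᵥ v ≤ qsRespScalar ρ T lo * (v ⬝ᵥ v) := by
  have hu : ∀ j, ∑ i, (0 : Fin 3 → ℝ) i * B i j = 0 * (0 : Fin 3 → ℝ) j := by intro j; simp
  have hlo : ∀ w : Fin 3 → ℝ, ∑ i, (0 : Fin 3 → ℝ) i * w i = 0 → lo * ∑ i, w i ^ 2 ≤ ∑ i, ∑ j, w i * B i j * w j := by
    intro w _; rw [sum_sum_eq_form, ← dotProduct_self_eq_sum_sq]; exact (hwin w).1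
  have hhi : ∀ w : Fin 3 → ℝ, ∑ i, (0 : Fin 3 → ℝ) i * w i = 0 → ∑ i, ∑ j, w i * B i j * w j ≤ hi * ∑ i, w i ^ 2 := by
    intro w _; rw [sum_sum_eq_form, ← dotProduct_self_eq_sum_sq]; exact (hwin w).2
  have hv : ∑ i, (0 : Fin 3 → ℝ) i * v i = 0 := by simp
  have low := le_sum_sum_mul_qsResp_mul (ρ := ρ) hT (fun τ hτ => le_sum_mul_exp_neg_smul_mulVec_of_perp hB hu hhi hv hτ)
  have upp := sum_sum_mul_qsResp_mul_le (ρ := ρ) hT (fun τ hτ => sum_mul_exp_neg_smul_mulVec_le_of_perp hB hu hlo hv hτ)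
  rw [sum_sum_eq_form, ← dotProduct_self_eq_sum_sq] at low upp
  exact ⟨low, upp⟩

/-- … on the `P_s`-projected vectors, in the `perpSq` currency of `…OddGainDefectGram`: the extra clause of `oddSectorial_excQS_strict_of_slot`
for a symmetric block, with the slot window `[f_{T_s}(hi), f_{T_s}(lo)]`. [folklore] -/
theorem qsResp_window_symm_projPerp {ρ T lo hi : ℝ} (hT : 0 ≤ T) {B : Matrix (Fin 3) (Fin 3) ℝ} (hB : B.IsSymm)
    (hwin : ∀ x : Fin 3 → ℝ, lo * (x ⬝ᵥ x) ≤ x ⬝ᵥ B *ᵥ x ∧ x ⬝ᵥ B *ᵥ x ≤ hi * (x ⬝ᵥ x)) (s : Fin 26) (x : Fin 3 → ℝ) :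
    qsRespScalar ρ T hi * perpSq (slotN s) x ≤ ((projPerp (slotN s)) *ᵥ x) ⬝ᵥ (qsResp ρ T B) *ᵥ ((projPerp (slotN s)) *ᵥ x) ∧
    ((projPerp (slotN s)) *ᵥ x) ⬝ᵥ (qsResp ρ T B) *ᵥ ((projPerp (slotN s)) *ᵥ x) ≤ qsRespScalar ρ T lo * perpSq (slotN s) x := by
  have hn : ∑ a, slotN s a ^ 2 = 1 := by rw [← dotProduct_self_eq_sum_sq]; exact slotN_unit s
  rw [← perpSq_eq_projPerp (slotN s) x hn]
  exact qsResp_window_symm hT hB hwin _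

end Windows

end Summit.AnomalousDissipation.AnomalousDissipation.Theorems.SolenoidalFractalHomogenisation.LagrangianStep.OddGain

end
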